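import Literature.AlgebraicGeometry.Deformation.SmoothSchemeLiftObstructionCechCocycleIdentity
import Literature.AlgebraicGeometry.Deformation.PairLiftTwistedCocycleObstruction
import HarnessLib

/-!
# The obstruction cochain of an invertible sheaf along a lift of the scheme is a Čech `2`-cocycle
# (Hartshorne DT Thm. 6.4 (a): «an obstruction `δ ∈ H²(J ⊗ 𝒪_X)`» — the fourfold identity, gluing dialect)

Layer `Literature/AlgebraicGeometry/Deformation` (cell `hodgecm-mathlib`, F-11 α1 grandchild `F11LiftWithLineBundle`, stub G2
(iii-a); theorems only — no definition, no instance, no notation, no named fact).  Sequel of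
`Deformation/PairLiftTwistedCocycleObstruction` (the cochain `s` with `G_{jm}|·(1 + t ⊗ s_{jlm}) = G_{jl}|·τ_{jl}(G_{lm}|)`) in the
currency of `Deformation/SmoothSchemeLiftObstructionCechCocycle{,Identity}` (lifted gluing data `ψ` on a principal affine cover of
the closed fibre, characterised base changes and restrictions):

* **`pairObstructionCochain_cocycle`** — if the `ψ` are COCYCLE-EXACT on triple overlaps (`ρ_{lm} ρ_{jl} = ρ_{jm}` for their
  characterised restrictions, the `∀`-form of `Deformation/SmoothSchemeLiftObstructionCriterion`), then for every `j l m n`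
  `s_{lmn}| − s_{jmn}| + s_{jln}| − s_{jlm}| = 0` in `Γ(U j ∩ U l ∩ U m ∩ U n, 𝒪_X)`.
  Proof: restrict the four defect relations to the fourfold overlap (two routes to a pairwise datum agree,
  `compat_of_restrict_of_restrict`), read the three transports there as `σ_{jl}⁻¹, σ_{lm}⁻¹, σ_{jm}⁻¹` for the restrictions
  `σ` of the `ψ`'s (which compose: `σ_{lm} σ_{jl} = σ_{jm}`), and apply the ring-level identity
  `SmoothAffineDeformation.twistedDefect_fourfold_add` (`Deformation/TwistedUnitCocycleSmallExtension`).

HC_CM is proved only modulo the 7 printed citations until rung 0 closes — nothing here bears on a summit statement.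

## References
* [Hartshorne2010] R. Hartshorne, *Deformation Theory*, GTM 257 (2010): Thm. 6.4 (a) and proof (pp. 50–51), Thm. 10.2 (a) proof (p. 81).
* [Oort1971] F. Oort, *Finite group schemes, local moduli for abelian varieties, and lifting problems*, Compositio Math. 23 (1971), §2.3.
-/

noncomputable section

-- `TopCat.Presheaf`/`TopCat.Sheaf` are not reducible (as in Mathlib's `AlgebraicGeometry/Modules`).
set_option backward.isDefEq.respectTransparency false

open CategoryTheory AlgebraicGeometry Opposite TopologicalSpace
open scoped TensorProduct

universe u

namespace Literature.AlgebraicGeometry.Deformation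

open Literature.AlgebraicGeometry.HodgeTheory Literature.AlgebraicGeometry.Modules
  Literature.AlgebraicGeometry.Motives Literature.AlgebraicGeometry.Morphisms SmoothAffineDeformation

variable {k : Type u} [Field k] {X : Over (Spec (CommRingCat.of k))}
  [instΓ : ∀ W : X.left.Opens, Algebra k Γ(X.left, W)]
  (halg : ∀ (W : X.left.Opens) (s : k), algebraMap k Γ(X.left, W) s = (constToPresheaf X).app (op W) s)
  {A' : Type u} [CommRing A'] [Algebra k A']

section Cocycle

variable {ι : Type u} (U : ι → X.left.affineOpens) (b : (j l : ι) → Γ(X.left, (U j).1))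
  (hb : ∀ j l, (U j).1 ⊓ (U l).1 = X.left.basicOpen (b j l))
  (J 𝔫' : Ideal A') (e : ↥(J.restrictScalars k) ≃ₗ[k] k)

set_option maxHeartbeats 400000 in
include halg hb in
/-- **THE OBSTRUCTION COCHAIN OF THE PAIR IS A `2`-COCYCLE.**  For lifted gluing data `ψ ≡ 1 (mod 𝔫')` that are COCYCLE-EXACT
(`hcocψ`, the `∀`-form: the characterised restrictions compose on triple overlaps), lifted units `G j l ≡ 1 ⊗ g j l (mod 𝔫')`
(`g` units) and a cochain `s` with `G_{jm}| · (1 + t ⊗ s_{jlm}) = G_{jl}| · τ_{jl}(G_{lm}|)` for all characterised data (`hs`, the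
output of `exists_pairObstructionCochain`): `s_{lmn}| − s_{jmn}| + s_{jln}| − s_{jlm}| = 0` on every fourfold overlap.
[cite: Hartshorne2010, Thm. 6.4 (a) and proof, pp. 50–51] [cite: Hartshorne2010, Thm. 10.2 (proof), p. 81] [cite: Oort1971, §2.3] -/
theorem pairObstructionCochain_cocycle (h𝔫 : IsNilpotent 𝔫') (hJ : J * J = ⊥) (hJ𝔫 : J * 𝔫' = ⊥)
    (ψ : (j l : ι) → A' ⊗[k] Γ(X.left, (U j).1 ⊓ (U l).1) ≃ₐ[A'] A' ⊗[k] Γ(X.left, (U j).1 ⊓ (U l).1))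
    (hψ : ∀ j l x, ψ j l x - x ∈ 𝔫' • (⊤ : Submodule A' (A' ⊗[k] Γ(X.left, (U j).1 ⊓ (U l).1))))
    (hcocψ : ∀ (j l m : ι)
      (Φjl : A' ⊗[k] Γ(X.left, (U j).1 ⊓ (U l).1) →ₐ[A'] A' ⊗[k] Γ(X.left, (U j).1 ⊓ (U l).1 ⊓ (U m).1))
      (_ : ∀ a s, Φjl (a ⊗ₜ s) = a ⊗ₜ X.left.presheaf.map (homOfLE inf_le_left).op s)
      (Φlm : A' ⊗[k] Γ(X.left, (U l).1 ⊓ (U m).1) →ₐ[A'] A' ⊗[k] Γ(X.left, (U j).1 ⊓ (U l).1 ⊓ (U m).1))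
      (_ : ∀ a s, Φlm (a ⊗ₜ s) = a ⊗ₜ X.left.presheaf.map
        (homOfLE (le_inf (inf_le_left.trans inf_le_right) inf_le_right)).op s)
      (Φjm : A' ⊗[k] Γ(X.left, (U j).1 ⊓ (U m).1) →ₐ[A'] A' ⊗[k] Γ(X.left, (U j).1 ⊓ (U l).1 ⊓ (U m).1))
      (_ : ∀ a s, Φjm (a ⊗ₜ s) = a ⊗ₜ X.left.presheaf.map
        (homOfLE (le_inf (inf_le_left.trans inf_le_left) inf_le_right)).op s)
      (ρjl ρlm ρjm : A' ⊗[k] Γ(X.left, (U j).1 ⊓ (U l).1 ⊓ (U m).1) ≃ₐ[A']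
        A' ⊗[k] Γ(X.left, (U j).1 ⊓ (U l).1 ⊓ (U m).1)),
      (∀ x, ρjl (Φjl x) = Φjl (ψ j l x)) → (∀ x, ρlm (Φlm x) = Φlm (ψ l m x)) →
      (∀ x, ρjm (Φjm x) = Φjm (ψ j m x)) → ρlm * ρjl = ρjm)
    (G : (j l : ι) → A' ⊗[k] Γ(X.left, (U j).1 ⊓ (U l).1)) (g : (j l : ι) → Γ(X.left, (U j).1 ⊓ (U l).1))
    (hg : ∀ j l, IsUnit (g j l))
    (hG : ∀ j l, G j l - (1 : A') ⊗ₜ g j l ∈ 𝔫' • (⊤ : Submodule A' (A' ⊗[k] Γ(X.left, (U j).1 ⊓ (U l).1))))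
    (s : (j l m : ι) → Γ(X.left, (U j).1 ⊓ (U l).1 ⊓ (U m).1))
    (hs : ∀ (j l m : ι)
      (Φjl : A' ⊗[k] Γ(X.left, (U j).1 ⊓ (U l).1) →ₐ[A'] A' ⊗[k] Γ(X.left, (U j).1 ⊓ (U l).1 ⊓ (U m).1))
      (_ : ∀ a s, Φjl (a ⊗ₜ s) = a ⊗ₜ X.left.presheaf.map (homOfLE inf_le_left).op s)
      (Φlm : A' ⊗[k] Γ(X.left, (U l).1 ⊓ (U m).1) →ₐ[A'] A' ⊗[k] Γ(X.left, (U j).1 ⊓ (U l).1 ⊓ (U m).1))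
      (_ : ∀ a s, Φlm (a ⊗ₜ s) = a ⊗ₜ X.left.presheaf.map
        (homOfLE (le_inf (inf_le_left.trans inf_le_right) inf_le_right)).op s)
      (Φjm : A' ⊗[k] Γ(X.left, (U j).1 ⊓ (U m).1) →ₐ[A'] A' ⊗[k] Γ(X.left, (U j).1 ⊓ (U l).1 ⊓ (U m).1))
      (_ : ∀ a s, Φjm (a ⊗ₜ s) = a ⊗ₜ X.left.presheaf.map
        (homOfLE (le_inf (inf_le_left.trans inf_le_left) inf_le_right)).op s)
      (τjl : A' ⊗[k] Γ(X.left, (U j).1 ⊓ (U l).1 ⊓ (U m).1) ≃ₐ[A'] A' ⊗[k] Γ(X.left, (U j).1 ⊓ (U l).1 ⊓ (U m).1)),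
      (∀ x, τjl (Φjl (ψ j l x)) = Φjl x) →
      Φjm (G j m) * (1 + ((e.symm 1 : ↥(J.restrictScalars k)) : A') ⊗ₜ s j l m) = Φjl (G j l) * τjl (Φlm (G l m)))
    (j l m n : ι) :
    X.left.presheaf.map (homOfLE (le_inf (le_inf (inf_le_left.trans (inf_le_left.trans inf_le_right))
          (inf_le_left.trans inf_le_right)) inf_le_right :
        (U j).1 ⊓ (U l).1 ⊓ (U m).1 ⊓ (U n).1 ≤ (U l).1 ⊓ (U m).1 ⊓ (U n).1)).op (s l m n) -
      X.left.presheaf.map (homOfLE (le_inf (le_inf (inf_le_left.trans (inf_le_left.trans inf_le_left))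
          (inf_le_left.trans inf_le_right)) inf_le_right :
        (U j).1 ⊓ (U l).1 ⊓ (U m).1 ⊓ (U n).1 ≤ (U j).1 ⊓ (U m).1 ⊓ (U n).1)).op (s j m n) +
      X.left.presheaf.map (homOfLE (le_inf (inf_le_left.trans inf_le_left) inf_le_right :
        (U j).1 ⊓ (U l).1 ⊓ (U m).1 ⊓ (U n).1 ≤ (U j).1 ⊓ (U l).1 ⊓ (U n).1)).op (s j l n) -
      X.left.presheaf.map (homOfLE (inf_le_left :
        (U j).1 ⊓ (U l).1 ⊓ (U m).1 ⊓ (U n).1 ≤ (U j).1 ⊓ (U l).1 ⊓ (U m).1)).op (s j l m) = 0 := by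
  classical
  -- the triple overlaps are principal in the pairwise ones; base changes; restrictions of the `ψ`
  have hW₃jl : ∀ j l m : ι, (U j).1 ⊓ (U l).1 ⊓ (U m).1 =
      X.left.basicOpen (X.left.presheaf.map (homOfLE (inf_le_left : (U j).1 ⊓ (U l).1 ≤ (U j).1)).op (b j m)) :=
    fun j l m => inf_eq_basicOpen_map U b hb inf_le_left m
  have hW₃lm : ∀ j l m : ι, (U j).1 ⊓ (U l).1 ⊓ (U m).1 =
      X.left.basicOpen (X.left.presheaf.map (homOfLE (inf_le_left : (U l).1 ⊓ (U m).1 ≤ (U l).1)).op (b l j)) :=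
    fun j l m => by
      rw [← inf_eq_basicOpen_map U b hb inf_le_left j]
      ac_rfl
  have hW₃jm : ∀ j l m : ι, (U j).1 ⊓ (U l).1 ⊓ (U m).1 =
      X.left.basicOpen (X.left.presheaf.map (homOfLE (inf_le_left : (U j).1 ⊓ (U m).1 ≤ (U j).1)).op (b j l)) :=
    fun j l m => by
      rw [← inf_eq_basicOpen_map U b hb inf_le_left l]
      ac_rfl
  have hΦjl := fun j l m : ι => exists_baseChangeMap (A' := A') halg ((U j).1 ⊓ (U l).1)
    ((U j).1 ⊓ (U l).1 ⊓ (U m).1) inf_le_left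
  have hΦlm := fun j l m : ι => exists_baseChangeMap (A' := A') halg ((U l).1 ⊓ (U m).1)
    ((U j).1 ⊓ (U l).1 ⊓ (U m).1) (le_inf (inf_le_left.trans inf_le_right) inf_le_right)
  have hΦjm := fun j l m : ι => exists_baseChangeMap (A' := A') halg ((U j).1 ⊓ (U m).1)
    ((U j).1 ⊓ (U l).1 ⊓ (U m).1) (le_inf (inf_le_left.trans inf_le_left) inf_le_right)
  choose Φjl hΦjl using hΦjl
  choose Φlm hΦlm using hΦlm
  choose Φjm hΦjm using hΦjm
  have hρjl := fun j l m : ι => exists_algEquiv_restrict halg 𝔫' (isAffineOpen_inf₂ U b hb j l) _ (hW₃jl j l m)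
    inf_le_left h𝔫 (ψ j l) (hψ j l) (hΦjl j l m)
  have hρlm := fun j l m : ι => exists_algEquiv_restrict halg 𝔫' (isAffineOpen_inf₂ U b hb l m) _ (hW₃lm j l m)
    (le_inf (inf_le_left.trans inf_le_right) inf_le_right) h𝔫 (ψ l m) (hψ l m) (hΦlm j l m)
  have hρjm := fun j l m : ι => exists_algEquiv_restrict halg 𝔫' (isAffineOpen_inf₂ U b hb j m) _ (hW₃jm j l m)
    (le_inf (inf_le_left.trans inf_le_left) inf_le_right) h𝔫 (ψ j m) (hψ j m) (hΦjm j l m)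
  choose ρjl hρjl hρjl𝔫 using hρjl
  choose ρlm hρlm hρlm𝔫 using hρlm
  choose ρjm hρjm hρjm𝔫 using hρjm
  -- on each triple: the transitions compose, and the defect relation with `τ := (ρjl)⁻¹`
  have hcoc₃ : ∀ x y z : ι, ρlm x y z * ρjl x y z = ρjm x y z := fun x y z =>
    hcocψ x y z (Φjl x y z) (hΦjl x y z) (Φlm x y z) (hΦlm x y z) (Φjm x y z) (hΦjm x y z)
      (ρjl x y z) (ρlm x y z) (ρjm x y z) (hρjl x y z) (hρlm x y z) (hρjm x y z)
  have hrel₃ : ∀ x y z : ι, Φjm x y z (G x z) * (1 + ((e.symm 1 : ↥(J.restrictScalars k)) : A') ⊗ₜ s x y z) =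
      Φjl x y z (G x y) * (ρjl x y z)⁻¹ (Φlm x y z (G y z)) := fun x y z =>
    hs x y z (Φjl x y z) (hΦjl x y z) (Φlm x y z) (hΦlm x y z) (Φjm x y z) (hΦjm x y z) (ρjl x y z)⁻¹
      (fun w => by rw [← hρjl, AlgEquiv.aut_inv, AlgEquiv.symm_apply_apply])
  -- the fourfold overlap `W₄`, principal in the four triples and in the six pairs
  set W₄ : X.left.Opens := (U j).1 ⊓ (U l).1 ⊓ (U m).1 ⊓ (U n).1 with hW₄def
  have hW₄aff : IsAffineOpen W₄ := isAffineOpen_inf₄ U b hb j l m n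
  have le_jlm : W₄ ≤ (U j).1 ⊓ (U l).1 ⊓ (U m).1 := inf_le_left
  have le_jln : W₄ ≤ (U j).1 ⊓ (U l).1 ⊓ (U n).1 := le_inf (inf_le_left.trans inf_le_left) inf_le_right
  have le_jmn : W₄ ≤ (U j).1 ⊓ (U m).1 ⊓ (U n).1 :=
    le_inf (le_inf (inf_le_left.trans (inf_le_left.trans inf_le_left)) (inf_le_left.trans inf_le_right)) inf_le_right
  have le_lmn : W₄ ≤ (U l).1 ⊓ (U m).1 ⊓ (U n).1 :=
    le_inf (le_inf (inf_le_left.trans (inf_le_left.trans inf_le_right)) (inf_le_left.trans inf_le_right)) inf_le_right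
  have h4jlm : W₄ = X.left.basicOpen (X.left.presheaf.map
      (homOfLE (inf_le_left.trans inf_le_left : (U j).1 ⊓ (U l).1 ⊓ (U m).1 ≤ (U j).1)).op (b j n)) :=
    inf_eq_basicOpen_map U b hb _ n
  have h4jln : W₄ = X.left.basicOpen (X.left.presheaf.map
      (homOfLE (inf_le_left.trans inf_le_left : (U j).1 ⊓ (U l).1 ⊓ (U n).1 ≤ (U j).1)).op (b j m)) := by
    rw [← inf_eq_basicOpen_map U b hb _ m, hW₄def]; ac_rfl
  have h4jmn : W₄ = X.left.basicOpen (X.left.presheaf.map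
      (homOfLE (inf_le_left.trans inf_le_left : (U j).1 ⊓ (U m).1 ⊓ (U n).1 ≤ (U j).1)).op (b j l)) := by
    rw [← inf_eq_basicOpen_map U b hb _ l, hW₄def]; ac_rfl
  have h4lmn : W₄ = X.left.basicOpen (X.left.presheaf.map
      (homOfLE (inf_le_left.trans inf_le_left : (U l).1 ⊓ (U m).1 ⊓ (U n).1 ≤ (U l).1)).op (b l j)) := by
    rw [← inf_eq_basicOpen_map U b hb _ j, hW₄def]; ac_rfl
  have h4jl : W₄ = X.left.basicOpen
      (X.left.presheaf.map (homOfLE (inf_le_left : (U j).1 ⊓ (U l).1 ≤ (U j).1)).op (b j m) *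
        X.left.presheaf.map (homOfLE (inf_le_left : (U j).1 ⊓ (U l).1 ≤ (U j).1)).op (b j n)) := by
    rw [← inf_inf_eq_basicOpen_map U b hb _ m n, hW₄def]
  have h4jm : W₄ = X.left.basicOpen
      (X.left.presheaf.map (homOfLE (inf_le_left : (U j).1 ⊓ (U m).1 ≤ (U j).1)).op (b j l) *
        X.left.presheaf.map (homOfLE (inf_le_left : (U j).1 ⊓ (U m).1 ≤ (U j).1)).op (b j n)) := by
    rw [← inf_inf_eq_basicOpen_map U b hb _ l n, hW₄def]; ac_rfl
  have h4lm : W₄ = X.left.basicOpen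
      (X.left.presheaf.map (homOfLE (inf_le_left : (U l).1 ⊓ (U m).1 ≤ (U l).1)).op (b l j) *
        X.left.presheaf.map (homOfLE (inf_le_left : (U l).1 ⊓ (U m).1 ≤ (U l).1)).op (b l n)) := by
    rw [← inf_inf_eq_basicOpen_map U b hb _ j n, hW₄def]; ac_rfl
  -- base changes from the four triples to `W₄`, and from the six pairs to `W₄`
  obtain ⟨Ξjlm, hΞjlm⟩ := exists_baseChangeMap (A' := A') halg _ W₄ le_jlm
  obtain ⟨Ξjln, hΞjln⟩ := exists_baseChangeMap (A' := A') halg _ W₄ le_jln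
  obtain ⟨Ξjmn, hΞjmn⟩ := exists_baseChangeMap (A' := A') halg _ W₄ le_jmn
  obtain ⟨Ξlmn, hΞlmn⟩ := exists_baseChangeMap (A' := A') halg _ W₄ le_lmn
  have le₂jl : W₄ ≤ (U j).1 ⊓ (U l).1 := le_jlm.trans inf_le_left
  have le₂jm : W₄ ≤ (U j).1 ⊓ (U m).1 := le_jmn.trans inf_le_left
  have le₂jn : W₄ ≤ (U j).1 ⊓ (U n).1 := le_jln.trans (le_inf (inf_le_left.trans inf_le_left) inf_le_right)
  have le₂lm : W₄ ≤ (U l).1 ⊓ (U m).1 := le_lmn.trans inf_le_left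
  have le₂ln : W₄ ≤ (U l).1 ⊓ (U n).1 := le_lmn.trans (le_inf (inf_le_left.trans inf_le_left) inf_le_right)
  have le₂mn : W₄ ≤ (U m).1 ⊓ (U n).1 := le_lmn.trans (le_inf (inf_le_left.trans inf_le_right) inf_le_right)
  obtain ⟨Λjl, hΛjl⟩ := exists_baseChangeMap (A' := A') halg _ W₄ le₂jl
  obtain ⟨Λjm, hΛjm⟩ := exists_baseChangeMap (A' := A') halg _ W₄ le₂jm
  obtain ⟨Λjn, hΛjn⟩ := exists_baseChangeMap (A' := A') halg _ W₄ le₂jn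
  obtain ⟨Λlm, hΛlm⟩ := exists_baseChangeMap (A' := A') halg _ W₄ le₂lm
  obtain ⟨Λln, hΛln⟩ := exists_baseChangeMap (A' := A') halg _ W₄ le₂ln
  obtain ⟨Λmn, hΛmn⟩ := exists_baseChangeMap (A' := A') halg _ W₄ le₂mn
  -- two-step base changes are one-step
  have cjl₁ : ∀ y, Ξjlm (Φjl j l m y) = Λjl y := baseChangeMap_comp_apply _ _ (hΦjl j l m) hΞjlm hΛjl
  have cjl₂ : ∀ y, Ξjln (Φjl j l n y) = Λjl y := baseChangeMap_comp_apply _ _ (hΦjl j l n) hΞjln hΛjl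
  have cjm₁ : ∀ y, Ξjlm (Φjm j l m y) = Λjm y := baseChangeMap_comp_apply _ _ (hΦjm j l m) hΞjlm hΛjm
  have cjm₂ : ∀ y, Ξjmn (Φjl j m n y) = Λjm y := baseChangeMap_comp_apply _ _ (hΦjl j m n) hΞjmn hΛjm
  have cjn₁ : ∀ y, Ξjln (Φjm j l n y) = Λjn y := baseChangeMap_comp_apply _ _ (hΦjm j l n) hΞjln hΛjn
  have cjn₂ : ∀ y, Ξjmn (Φjm j m n y) = Λjn y := baseChangeMap_comp_apply _ _ (hΦjm j m n) hΞjmn hΛjn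
  have clm₁ : ∀ y, Ξjlm (Φlm j l m y) = Λlm y := baseChangeMap_comp_apply _ _ (hΦlm j l m) hΞjlm hΛlm
  have clm₂ : ∀ y, Ξlmn (Φjl l m n y) = Λlm y := baseChangeMap_comp_apply _ _ (hΦjl l m n) hΞlmn hΛlm
  have cln₁ : ∀ y, Ξjln (Φlm j l n y) = Λln y := baseChangeMap_comp_apply _ _ (hΦlm j l n) hΞjln hΛln
  have cln₂ : ∀ y, Ξlmn (Φjm l m n y) = Λln y := baseChangeMap_comp_apply _ _ (hΦjm l m n) hΞlmn hΛln
  have cmn₁ : ∀ y, Ξjmn (Φlm j m n y) = Λmn y := baseChangeMap_comp_apply _ _ (hΦlm j m n) hΞjmn hΛmn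
  have cmn₂ : ∀ y, Ξlmn (Φlm l m n y) = Λmn y := baseChangeMap_comp_apply _ _ (hΦlm l m n) hΞlmn hΛmn
  -- the restrictions to `W₄` of `ψ j l`, `ψ l m`, `ψ j m` (through the triple `jlm`) …
  obtain ⟨σjl, hσjl, hσjl𝔫⟩ := exists_algEquiv_restrict halg 𝔫' (isAffineOpen_inf₃ U b hb j l m) _ h4jlm le_jlm h𝔫
    (ρjl j l m) (hρjl𝔫 j l m) hΞjlm
  obtain ⟨σlm, hσlm, -⟩ := exists_algEquiv_restrict halg 𝔫' (isAffineOpen_inf₃ U b hb j l m) _ h4jlm le_jlm h𝔫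
    (ρlm j l m) (hρlm𝔫 j l m) hΞjlm
  obtain ⟨σjm, hσjm, -⟩ := exists_algEquiv_restrict halg 𝔫' (isAffineOpen_inf₃ U b hb j l m) _ h4jlm le_jlm h𝔫
    (ρjm j l m) (hρjm𝔫 j l m) hΞjlm
  -- … compose on `W₄`, …
  have hcoc₄ : ∀ x, σjl⁻¹ (σlm⁻¹ x) = σjm⁻¹ x := by
    have hprod : ∀ y, (σlm * σjl) (Ξjlm y) = Ξjlm ((ρjm j l m) y) := fun y => by
      rw [algEquiv_restrict_mul hσlm hσjl, hcoc₃]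
    have heq : σlm * σjl = σjm :=
      algEquiv_restrict_unique halg (isAffineOpen_inf₃ U b hb j l m) _ h4jlm le_jlm (ρjm j l m) hΞjlm hprod hσjm
    intro x
    rw [← heq, mul_inv_rev, AlgEquiv.mul_apply]
  -- … and also restrict the `ρ`'s chosen through the other three triples (two routes agree)
  have hσjl' : ∀ y, σjl (Ξjln y) = Ξjln (ρjl j l n y) :=
    compat_of_restrict_of_restrict halg 𝔫' (isAffineOpen_inf₂ U b hb j l) _ h4jl inf_le_left inf_le_left le_jlm
      le_jln (isAffineOpen_inf₃ U b hb j l n) _ h4jln h𝔫 (ψ j l) (hΦjl j l m) (hΦjl j l n) hΞjlm hΞjln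
      (hρjl j l m) (hρjl j l n) (hρjl𝔫 j l n) hσjl
  have hσjm' : ∀ y, σjm (Ξjmn y) = Ξjmn (ρjl j m n y) :=
    compat_of_restrict_of_restrict halg 𝔫' (isAffineOpen_inf₂ U b hb j m) _ h4jm
      (le_inf (inf_le_left.trans inf_le_left) inf_le_right) inf_le_left le_jlm le_jmn
      (isAffineOpen_inf₃ U b hb j m n) _ h4jmn h𝔫 (ψ j m) (hΦjm j l m) (hΦjl j m n) hΞjlm hΞjmn
      (hρjm j l m) (hρjl j m n) (hρjl𝔫 j m n) hσjm
  have hσlm' : ∀ y, σlm (Ξlmn y) = Ξlmn (ρjl l m n y) :=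
    compat_of_restrict_of_restrict halg 𝔫' (isAffineOpen_inf₂ U b hb l m) _ h4lm
      (le_inf (inf_le_left.trans inf_le_right) inf_le_right) inf_le_left le_jlm le_lmn
      (isAffineOpen_inf₃ U b hb l m n) _ h4lmn h𝔫 (ψ l m) (hΦlm j l m) (hΦjl l m n) hΞjlm hΞlmn
      (hρlm j l m) (hρjl l m n) (hρjl𝔫 l m n) hσlm
  -- the four defect relations on `W₄`
  have hΞt : ∀ {V : X.left.Opens} (hV : W₄ ≤ V) {Ξ : A' ⊗[k] Γ(X.left, V) →ₐ[A'] A' ⊗[k] Γ(X.left, W₄)}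
      (hΞ : ∀ a s, Ξ (a ⊗ₜ s) = a ⊗ₜ X.left.presheaf.map (homOfLE hV).op s) (c : Γ(X.left, V)),
      Ξ (1 + ((e.symm 1 : ↥(J.restrictScalars k)) : A') ⊗ₜ c) =
        1 + idealTensorIncl J (X.left.presheaf.map (homOfLE hV).op c ⊗ₜ[k] e.symm 1) := by
    intro V hV Ξ hΞ c
    rw [map_add, map_one, hΞ, idealTensorIncl_tmul]
  have h1 : Λjm (G j m) * (1 + idealTensorIncl J (X.left.presheaf.map (homOfLE le_jlm).op (s j l m) ⊗ₜ[k] e.symm 1)) =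
      Λjl (G j l) * σjl⁻¹ (Λlm (G l m)) := by
    have h := congrArg (Ξjlm) (hrel₃ j l m)
    rw [map_mul, map_mul, hΞt le_jlm hΞjlm, cjm₁, cjl₁, ← algEquiv_restrict_inv hσjl, clm₁] at h
    exact h
  have h3 : Λjn (G j n) * (1 + idealTensorIncl J (X.left.presheaf.map (homOfLE le_jln).op (s j l n) ⊗ₜ[k] e.symm 1)) =
      Λjl (G j l) * σjl⁻¹ (Λln (G l n)) := by
    have h := congrArg (Ξjln) (hrel₃ j l n)
    rw [map_mul, map_mul, hΞt le_jln hΞjln, cjn₁, cjl₂, ← algEquiv_restrict_inv hσjl', cln₁] at h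
    exact h
  have h2 : Λjn (G j n) * (1 + idealTensorIncl J (X.left.presheaf.map (homOfLE le_jmn).op (s j m n) ⊗ₜ[k] e.symm 1)) =
      Λjm (G j m) * σjm⁻¹ (Λmn (G m n)) := by
    have h := congrArg (Ξjmn) (hrel₃ j m n)
    rw [map_mul, map_mul, hΞt le_jmn hΞjmn, cjn₂, cjm₂, ← algEquiv_restrict_inv hσjm', cmn₁] at h
    exact h
  have h4 : Λln (G l n) * (1 + idealTensorIncl J (X.left.presheaf.map (homOfLE le_lmn).op (s l m n) ⊗ₜ[k] e.symm 1)) =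
      Λlm (G l m) * σlm⁻¹ (Λmn (G m n)) := by
    have h := congrArg (Ξlmn) (hrel₃ l m n)
    rw [map_mul, map_mul, hΞt le_lmn hΞlmn, cln₂, clm₂, ← algEquiv_restrict_inv hσlm', cmn₂] at h
    exact h
  -- `σjl⁻¹ ≡ 1 (mod 𝔫')`; `G j n| ≡ 1 ⊗ g j n| (mod 𝔫')`
  have hτjl𝔫 : ∀ y, σjl⁻¹ y - y ∈ 𝔫' • (⊤ : Submodule A' (A' ⊗[k] Γ(X.left, W₄))) := fun y => by
    have hy : σjl⁻¹ y - y = -(σjl (σjl⁻¹ y) - σjl⁻¹ y) := by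
      rw [AlgEquiv.aut_inv, AlgEquiv.apply_symm_apply, neg_sub]
    rw [hy]
    exact Submodule.neg_mem _ (hσjl𝔫 _)
  have hGjn := baseChangeMap_sub_tmul_mem le₂jn hΛjn (hG j n)
  -- the ring-level fourfold identity
  have key := twistedDefect_fourfold_add J hJ𝔫 h𝔫 hJ σjl⁻¹ σlm⁻¹ σjm⁻¹ hτjl𝔫 hcoc₄
    ((hg j n).map (X.left.presheaf.map (homOfLE le₂jn).op).hom) hGjn h1 h2 h3 h4
  rw [← TensorProduct.sub_tmul, ← TensorProduct.add_tmul, ← TensorProduct.sub_tmul] at key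
  rw [← TensorProduct.zero_tmul Γ(X.left, W₄) (e.symm 1)] at key
  exact tmul_symm_one_injective J e key

end Cocycle

end Literature.AlgebraicGeometry.Deformation

end
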